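import Literature.MathematicalPhysics.QuantumFieldTheory.Balaban1983to89.B11Eq98CurrentSlot
import Literature.MathematicalPhysics.QuantumFieldTheory.Balaban1983to89.B9Eq3119DeltaPiCarrier

/-!
# `Balaban1983to89.B11Eq90CurrentAtLetters` — T. Bałaban, *The variational problem and background fields in renormalization group method for lattice gauge theories*, Commun. Math. Phys. **102** (1985) 277–309 [Balaban1985Variational]: (80), (84)–(90) pp. 290–291, (27)/(28) p. 282; [5] = T. Bałaban, CMP **99** (1985) [Balaban1985BackgroundPropagators] (3.119) p. 419 — `W = (δ/δA′)V` AT THE CHAIN'S LETTERS: `B11Eq80Current.W80` with BOTH operator letters INSTANTIATED by tree objects — `J :=` the current (27)/(28) in the carrier (`B11Eq98CurrentSlot.Jcur`), `Δπ :=` the gauge-invariant extension Δ_π of [5] (3.119) at the carrier (ne9-leaf-01's `B9Eq3119DeltaPiCarrier.deltaPiCLM`) —, its (63) certificate with the symmetry binder `hΔ` DISCHARGED (`deltaPiCLM_pair27_comm`), and both W-slot clauses with `‖J‖` discharged to the (14) display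

statement-level skeleton of published theorems with citation tags; proofs where landed; nothing here is a claim about the Yang–Mills mass gap

PDF held: `paper:balaban1985-cmp102-variational-background` (journal page = PDF page + 276); pp. 282, 290–293 read from the `lit read` text layer by
this seat (2026-08-21).

CITATION HEADER (lean-in-tree rule 2026-08-18).  WHAT IS REPRODUCED: the INSTANTIATION step of pub-balaban NE9 letter (L3) — rows `B11.Eq80`/
`B11.Prop4` of r08's `ROWS-B11.md` at the chain's own objects (the desk's (r4): «`J :=` r08's `B9Eq39Adjoint.J` read in the carrier and `Δπ :=`
leaf-01's `deltaPiCLM` are INSTANTIATIONS of typed letters»).  THE PRINT.  (80) p. 290, verbatim: *«V(A′) = −⟨HD₃(A′), J⟩ − ⟨A′, Δ_π HD(A′)⟩ +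
½⟨HD(A′), Δ_π HD(A′)⟩ + V₀(A′ − HD(A′))»*; (28) p. 282: *«J = D*η⁻² Im ∂U₀ = Im η⁻²D*∂U₀, |J| < C₁B₃ε₁(Lʲη)⁻³ on Ω_j, the bound holds by the
assumption (14)»*; [5] (3.119) p. 419: *«⟨A, Δ_π A⟩ = ⟨A − DG′RD*A, Δ(A − DG′RD*A)⟩»*.

WHAT IS DEFINED AND PROVED (sorry-free; axioms standard; two defs with bodies; no `Prop`-valued definition, no new named fact).
**`V80L`**, **`W80L L m φ U G′ lev₁ Dc ρ τ H C ε_C := W80 ρ τ U H C ε_C (Jcur U) (deltaPiCLM L m φ τ U G′ lev₁ Dc)`** : `Space115 Lr η lev₀ lev₁ Dc →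
NegSize Lr η lev₀ 3 𝔸`; **`pair27_W80L`** — `⟨W(A′), δ⟩ = (d/dt)V(A′ + tδ)|₀` on `‖A′‖ < a_C` given ONLY: the dualising identity `τ(ρ(ℓ)X) = ℓ X`,
`τ` tracial, the cell's norming `⟪φ⁻¹X, φ⁻¹Y⟫ = τ(X*Y)`, `U` unitary, `d ≥ 4`, the Sect. C regime of (47) and `Prop4Hyp C` (the symmetry of Δ_π is
leaf-01's THEOREM `deltaPiCLM_pair27_comm`, whatever `G′`); **`quadAnalytic_W80L`** — `QuadAnalytic (W80L …) C₄ R′ ∧ AnalyticOnNhd ℂ (W80L …)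
{‖Y‖ < R′}` with `C₄ = C4W ‖ρ‖ ‖τ‖ (C₁B₃ε₁) ‖Δπ‖ b C₂ ℓ θ₃ θ_E C_V R′` under the bondwise (14) display, the kernel-column letters θ_E, θ₃, g64's
`‖curV0 Y‖ ≤ C_V‖Y‖²`, the regime and the radii (`B11Eq98CurrentSlot.quadAnalytic_W80_Jcur`).

HONEST SCOPE — what is NOT claimed.  (i) `G′` (the Green's function of [5] (3.24)–(3.25) inside `π_U`) stays leaf-01's LETTER `Gp` (its
construction `GpOfU … hpos′` carries a displayed positivity); `‖Δπ‖`, θ_E, θ₃ displayed; uniformity not adjudicated.  (ii) Which Δ₁ the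
consumer's `𝔊` inverts decides whether `W80L` feeds with `Λ = 0` (print's Δ₁ of (79)) or with `Λ := −𝔊 ∘ L_J` (`B11Eq79LinearTerm`) — desk
J-79; not decided here.  (iii) `attribute [local instance 2000] levWeight.instFact` below is a ROBUSTNESS device only (the constant-weight
`Fact` instance of `B9Eq311L2Pairing`, in scope through leaf-01's imports, is otherwise tried first on `Fact (∀ b, 0 < levWeight …)` goals and
times out — X-reads R-ne9leaf06-g54-1 and R-ne9leaf06-g55-1); it changes no statement.  (iv) NOT summit progress (cell pub-balaban: NE9 NOT PRINTED / NOT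
PROVED; «NE9 ⇐ the named binders»; spine PROVED 0/9; HONEST DEPENDENCY: continuum YM on T⁴ ⇐ BetaPertH ∧ nine spine estimates (0/9 proved);
BetaPertH ⇐ (D1) ∧ (D4) ∧ CAP+tail; G-an2-4 gates asym, D1 and NE2/3/4).  Unit `b2b-balaban-t4-ne9-formalise-leaf-05` (NE9 crux-team leaf prover,
gen 65).  Imports `B11Eq98CurrentSlot` (this lineage) + `B9Eq3119DeltaPiCarrier` (ne9-leaf-01, p308383); modifies nothing.
-/

noncomputable section

open NormedSpace Complex Metric Set Finset Filter Topology
open scoped InnerProductSpace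

-- robustness (header (iii)): prefer the level-weight positivity instance on `Fact (∀ b, 0 < levWeight …)` goals
attribute [local instance 2000] Literature.MathematicalPhysics.QuantumFieldTheory.Balaban1983to89.B11Eq115Space.levWeight.instFact

namespace Literature.MathematicalPhysics.QuantumFieldTheory.Balaban1983to89.B11Eq90CurrentAtLetters

open Literature.MathematicalPhysics.QuantumFieldTheory.Balaban1983to89.B11Prop6Scheme (Prop4Hyp)
open Literature.MathematicalPhysics.QuantumFieldTheory.Balaban1983to89.B13Contraction113 (QuadAnalytic)
open Literature.MathematicalPhysics.QuantumFieldTheory.Balaban1983to89.B11Eq174Chart (Regime)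
open Literature.MathematicalPhysics.QuantumFieldTheory.Balaban1983to89.B11Eq90V0primeCurrent (Tsh Ucur flat115)
open Literature.MathematicalPhysics.QuantumFieldTheory.Balaban1983to89.B11Eq63V0GroupCurrent (curV0)
open Literature.MathematicalPhysics.QuantumFieldTheory.Balaban1983to89.B11Eq90Transpose (pair27 kernel)
open Literature.MathematicalPhysics.QuantumFieldTheory.Balaban1983to89.B11Eq80Current (Emap E3 V80 W80 pair27_W80)
open Literature.MathematicalPhysics.QuantumFieldTheory.Balaban1983to89.B11Eq98CurrentSlot (Jcur C4W quadAnalytic_W80_Jcur)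
open Literature.MathematicalPhysics.QuantumFieldTheory.Balaban1983to89.B9Eq3119DeltaPiCarrier (deltaPiCLM deltaPiCLM_pair27_comm)
open B9SectCLatticeCarrier (Bond)
open B9Eq319QprimeTorus (fineP)
open B11Eq103H1Complex (SiteL2K)
open B11Eq115Space

variable {d : ℕ} (L : ℕ) [NeZero L] (m : Fin d → ℕ) {𝔸 : Type*} [NormedRing 𝔸] [NormedAlgebra ℂ 𝔸] [StarRing 𝔸] [StarModule ℂ 𝔸]
  [FiniteDimensional ℂ 𝔸] [CompleteSpace 𝔸] {W : Type*} [NormedAddCommGroup W] [InnerProductSpace ℂ W] [FiniteDimensional ℂ W]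
  (φ : W ≃ₗ[ℂ] 𝔸) {c₀ : ℝ} [Fact (0 < c₀)] {Lr η : ℝ} [Fact (0 < Lr)] [Fact (0 < η)] (U : Bond d (fineP L m) → 𝔸ˣ)
  (Gp : SiteL2K ℂ d (fineP L m) c₀ W →ₗ[ℂ] SiteL2K ℂ d (fineP L m) c₀ W)
  {lev₀ : Bond d (fineP L m) → ℕ} {κ' : Type*} [Fintype κ'] (lev₁ : κ' → ℕ) (Dc : (Bond d (fineP L m) → 𝔸) →ₗ[ℂ] (κ' → 𝔸))
  {𝒳 : Type*} [NormedAddCommGroup 𝒳] [NormedSpace ℂ 𝒳]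

/-! ## §1 `V` and `W` at the chain's letters: `J := Jcur U`, `Δπ := deltaPiCLM …` -/

/-- **`V(A′)` OF (80) AT THE CHAIN'S LETTERS**: `V80` with `J :=` r08's current (27)/(28) in the carrier (`B11Eq98CurrentSlot.Jcur U`) and `Δπ :=`
leaf-01's `B9Eq3119DeltaPiCarrier.deltaPiCLM L m φ τ U G′ lev₁ Dc` ([5] (3.119) at the carrier). [cite: Balaban1985Variational, (80) p.290] -/
def V80L (ρ' : 𝔸 →L[ℂ] ℂ) (H : 𝒳 →L[ℂ] Space115 Lr η lev₀ lev₁ Dc) (C : Space115 Lr η lev₀ lev₁ Dc → 𝒳) (εC : ℝ)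
    (A' : Space115 Lr η lev₀ lev₁ Dc) : ℂ :=
  V80 ρ' U H C εC (Jcur (L := Lr) (η := η) (lev₀ := lev₀) U) (deltaPiCLM L m φ (ρ' : 𝔸 →ₗ[ℂ] ℂ) U Gp lev₁ Dc) A'

/-- **`W = (δ/δA′)V` AT THE CHAIN'S LETTERS** — `W80 ρ τ U H C ε_C (Jcur U) (deltaPiCLM L m φ τ U G′ lev₁ Dc)`: the (L3) letter with BOTH operator
letters INSTANTIATED by tree objects; remaining letters `ρ` (the dualising map, e.g. `rieszτ φ`), `τ`, `H`, `C`, `ε_C`, `G′`.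
[cite: Balaban1985Variational, (84)–(90) pp.290–291] -/
def W80L (ρ : (𝔸 →L[ℂ] ℂ) →L[ℂ] 𝔸) (τ : 𝔸 →L[ℂ] ℂ) (H : 𝒳 →L[ℂ] Space115 Lr η lev₀ lev₁ Dc) (C : Space115 Lr η lev₀ lev₁ Dc → 𝒳) (εC : ℝ) :
    Space115 Lr η lev₀ lev₁ Dc → NegSize Lr η lev₀ 3 𝔸 :=
  W80 ρ τ U H C εC (Jcur (L := Lr) (η := η) (lev₀ := lev₀) U) (deltaPiCLM L m φ (τ : 𝔸 →ₗ[ℂ] ℂ) U Gp lev₁ Dc)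

variable {H : 𝒳 →L[ℂ] Space115 Lr η lev₀ lev₁ Dc} {C : Space115 Lr η lev₀ lev₁ Dc → 𝒳} {b C₂ c₄ aC εC : ℝ}

/-- **THE (63) CERTIFICATE AT THE LETTERS, `hΔ` DISCHARGED** by leaf-01's `deltaPiCLM_pair27_comm` (tracial `τ`, the cell's norming
`⟪φ⁻¹X, φ⁻¹Y⟫ = τ(X*Y)`, unitary `U`): `⟨W(A′), δ⟩ = (d/dt)V(A′ + tδ)|₀` on `‖A′‖ < a_C`. [cite: Balaban1985Variational, (63) p.287, (84) p.290] -/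
theorem pair27_W80L [CompleteSpace 𝒳] {ρ : (𝔸 →L[ℂ] ℂ) →L[ℂ] 𝔸} {τ : 𝔸 →L[ℂ] ℂ}
    (hρ : ∀ (ℓ : 𝔸 →L[ℂ] ℂ) (X : 𝔸), τ (ρ ℓ * X) = ℓ X) (hτ : ∀ a b : 𝔸, τ (a * b) = τ (b * a))
    (hφ : ∀ X Y : 𝔸, ⟪φ.symm X, φ.symm Y⟫_ℂ = τ (star X * Y)) (hU : ∀ b, star (U b : 𝔸) = ((U b)⁻¹ : 𝔸ˣ)) (hd : 4 ≤ d)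
    (RC : Regime H 0 C b 0 C₂ c₄ 0 aC εC) (hC : Prop4Hyp C C₂ c₄) {A' : Space115 Lr η lev₀ lev₁ Dc} (hA' : ‖A'‖ < aC)
    (δ' : Space115 Lr η lev₀ lev₁ Dc) :
    pair27 τ (W80L L m φ U Gp lev₁ Dc ρ τ H C εC A') (flat115 δ')
      = deriv (fun t : ℂ => V80L L m φ U Gp lev₁ Dc τ H C εC (A' + t • δ')) 0 :=
  pair27_W80 hρ hτ hd U RC hC _ (deltaPiCLM_pair27_comm L m φ U Gp lev₁ Dc τ hτ hφ hU) hA' δ'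

/-- **BOTH W-SLOT CLAUSES AT THE LETTERS** (`J := Jcur U` with `‖J‖` discharged to the (14) display, `Δπ := deltaPiCLM …` whose norm enters as the
NEEDS-CONSTANT letter `‖deltaPiCLM …‖`), under the displayed kernel-column letters θ_E, θ₃, g64's `‖curV0 Y‖ ≤ C_V‖Y‖²`, the Sect. C regime and
the radii. [cite: Balaban1985Variational, Prop. 4 (97)–(98) pp.292–293] -/
theorem quadAnalytic_W80L [NormedStarGroup 𝔸] [CompleteSpace 𝒳] (ρ : (𝔸 →L[ℂ] ℂ) →L[ℂ] 𝔸) (τ : 𝔸 →L[ℂ] ℂ)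
    (hU : ∀ b, star (U b : 𝔸) = ((U b)⁻¹ : 𝔸ˣ)) {C₁ B₃ ε₁ : ℝ} (hK : 0 ≤ C₁ * B₃ * ε₁)
    (h14 : ∀ bb : Bond d (fineP L m), ‖B9Eq39Adjoint.divPη Tsh (Ucur U) η (B11Eq27Current.plaqField Tsh (Ucur U)) bb.2 bb.1‖
      ≤ C₁ * B₃ * ε₁ * η ^ 2 * (levWeight Lr η lev₀ 1 bb)⁻¹ ^ 3)
    {CV RV : ℝ} (hCV : 0 ≤ CV)
    (hqV : ∀ Y : Space115 Lr η lev₀ lev₁ Dc, ‖Y‖ < RV → ‖curV0 (lev₁ := lev₁) (Dc := Dc) ρ τ U Y‖ ≤ CV * ‖Y‖ ^ 2)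
    (RC : Regime H 0 C b 0 C₂ c₄ 0 aC εC) (hC : Prop4Hyp C C₂ c₄) {R' θ₃ θE : ℝ} (hθ₃ : 0 ≤ θ₃) (hθE : 0 ≤ θE) (hR'0 : 0 ≤ R')
    (hR'a : R' ≤ aC) (hR'V : R' ≤ (1 - 4 * b * C₂ * (εC + aC)) * RV)
    (hΘE : ∀ A' : Space115 Lr η lev₀ lev₁ Dc, ‖A'‖ < R' → ∀ bb, ∑ b', levWeight Lr η lev₀ 3 bb / levWeight Lr η lev₀ 3 b'
      * ‖kernel (fderiv ℂ (Emap H C εC) A') b' bb‖ ≤ θE * ‖A'‖)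
    (hΘ3 : ∀ A' : Space115 Lr η lev₀ lev₁ Dc, ‖A'‖ < R' → ∀ bb, ∑ b', levWeight Lr η lev₀ 3 bb / levWeight Lr η lev₀ 3 b'
      * ‖kernel (fderiv ℂ (E3 H C εC) A') b' bb‖ ≤ θ₃ * ‖A'‖ ^ 2) :
    QuadAnalytic (W80L L m φ U Gp lev₁ Dc ρ τ H C εC)
        (C4W ‖ρ‖ ‖τ‖ (C₁ * B₃ * ε₁) ‖deltaPiCLM (Lr := Lr) (η := η) (lev₀ := lev₀) L m φ (τ : 𝔸 →ₗ[ℂ] ℂ) U Gp lev₁ Dc‖ b C₂ (1 / (1 - 4 * b * C₂ * (εC + aC))) θ₃ θE CV R') R' ∧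
      AnalyticOnNhd ℂ (W80L L m φ U Gp lev₁ Dc ρ τ H C εC) {Y : Space115 Lr η lev₀ lev₁ Dc | ‖Y‖ < R'} :=
  quadAnalytic_W80_Jcur ρ τ U (fun bb => (hU bb).symm) hK h14 hCV hqV RC hC _ hθ₃ hθE hR'0 hR'a hR'V hΘE hΘ3

end Literature.MathematicalPhysics.QuantumFieldTheory.Balaban1983to89.B11Eq90CurrentAtLetters

end
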